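import Summits.ResolutionOfSingularities.ResolutionOfSingularities.Theorems.EquisingularLiftEquisingularLiftSecIdealExtension
import Summits.ResolutionOfSingularities.ResolutionOfSingularities.Theorems.EquisingularLiftEquisingularLiftLinearCentreCharts
import Summits.ResolutionOfSingularities.ResolutionOfSingularities.Theorems.EquisingularLiftEquisingularLiftStrictTransformBlowupModel
import Summits.ResolutionOfSingularities.ResolutionOfSingularities.Theorems.EquisingularLiftEquisingularLiftCurveCase
import Literature.AlgebraicGeometry.Motives.GeneratingSectionsEmbeddingFamily
import Literature.AlgebraicGeometry.Motives.ToProjFunctionField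
import Literature.AlgebraicGeometry.Motives.VarietiesProperProofs
import Literature.AlgebraicGeometry.Resolution.VertexBlowupRationalFunctions
import HarnessLib

/-!
# `EquisingularLift` (stmt-ResolutionOfSingularities-15660), line `Sketch` v10b — the registered stub
# `stub_linearCentre_of_blowupModel`: re-embedding a projective scheme so that an ideal sheaf becomes the restriction of a
# coordinate linear subspace

[OURS · L1 W4.5b] Registered stub of the crux `EquisingularLift`; NOT a statement of any manuscript.

Given a closed immersion `ι : H → ℙⁿ_k` of an integral scheme and a non-zero ideal sheaf `𝔞` on `H` all of whose blow-ups are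
regular, we produce `r, m`, the graded surjection `fk` killing the last `m` of `r + m + 1` variables, and a closed immersion
`j : H → ℙ^{r+m}_k` with `ker (Proj fk) · 𝒪_H = 𝔞`; hence `j(H) ⊄ V(ker (Proj fk))` and the reduced strict transform of `j(H)`
under every blow-up along `ker (Proj fk)` is regular (`isRegular_reducedStrictTransform_of_blowupModel`, p479286).

Construction (Hartshorne II Lemma 5.14, Thm. 7.1, Prop. 7.2, Cor. 7.15 in the tree's chart form): `D₀ = GeneratingSections.ofHom ι`
(charts `H_i = ι⁻¹ D₊(x_i)`, ratios `x_{i'}/x_i`); sections `τ i l` of `𝓛^{⊗N}` extending `k`-algebra generators `g` of the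
`Γ(H, H_i)` (`exists_sec_val_eq`) and generators `a` of the `𝔞(H_i)` WITH ALL CHART VALUES IN `𝔞` (`exists_sec_val_eq_mem_ideal`,
p479908) — `exists_adaptedFamily`; the closed immersion defined by `s_i^{⊗2N}`, `τ i l ⊗ s_i^{⊗N}`
(`GeneratingSections.isClosedImmersion_toProj_famData`, p480757) after a reindexing `Fin (r+m+1) ≃ Σ i, Option (L i)` putting the
`𝔞`-indices last (`exists_equiv_fin_isA`); and the chart computation `ker (Proj fk) · 𝒪_H = 𝔞` on the charts `H_i`
(`ker_projMap_kill_ideal_basicOpen` p479463, `ProjSpace.sec_eq_awayToSection`, `GeneratingSections.app_sec`, `famData_ratio_none`).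
-/

set_option linter.dupNamespace false -- mandated namespace `Summit.<Summit>.<Problem>` of this single-conjunct summit

noncomputable section

open CategoryTheory CategoryTheory.Limits AlgebraicGeometry TopologicalSpace
open MvPolynomial HomogeneousLocalization
open Literature.AlgebraicGeometry.Resolution
open Literature.AlgebraicGeometry.Motives Literature.AlgebraicGeometry.Motives.Segre
open Literature.AlgebraicGeometry.Motives.GeneratingSections (rs rs_rs rs_refl)

attribute [local instance] MvPolynomial.gradedAlgebra

namespace Summit.ResolutionOfSingularities.ResolutionOfSingularities.Cruxes.EquisingularLift.StrataSplit

namespace LinearCentre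

universe u

/-! ## Step C–E: the adapted family of sections -/

/-- **The adapted family of sections.** For generating-sections data `D` with finitely many affine charts over a field, `Y`
locally of finite type, and an ideal sheaf `𝔞` finitely generated on the charts: there are `N ≥ 1` and finitely many sections
`τ i l ∈ Γ(Y, 𝓛^{⊗N})` with home charts `i`, some of them flagged (`isA`), such that (1) `k` and the home values generate each
`Γ(Y, U i)`, (2) every chart value of a flagged section lies in `𝔞`, (3) the home values of the flagged sections of home `i`
generate `𝔞(U i)`. [cite: Hartshorne1977, II Lemma 5.14] -/
theorem exists_adaptedFamily {ι : Type} [Fintype ι] {Y : Scheme.{0}} (D : GeneratingSections ι Y)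
    {k : Type} [Field k] (f : Y ⟶ Spec (.of k)) [LocallyOfFiniteType f]
    (hU : ∀ i, IsAffineOpen (D.U i)) (𝔞 : Y.IdealSheafData) (h𝔞 : ∀ i, (𝔞.ideal ⟨D.U i, hU i⟩).FG) :
    ∃ (N : ℕ) (_ : 0 < N) (L : ι → Type) (_ : ∀ i, Fintype (L i)) (τ : ∀ i, L i → D.Sec N)
      (isA : ∀ i, L i → Prop),
      (∀ i, Subring.closure (Set.range (D.cstr f i) ∪ Set.range (fun l : L i => (τ i l).val i)) = ⊤) ∧
      (∀ i l, isA i l → ∀ j, (τ i l).val j ∈ 𝔞.ideal ⟨D.U j, hU j⟩) ∧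
      (∀ i, 𝔞.ideal ⟨D.U i, hU i⟩ ≤ Ideal.span (Set.range fun l : {l : L i // isA i l} => (τ i l.1).val i)) := by
  classical
  choose G hG using fun i => D.exists_finset_closure_eq_top f hU i
  choose A hA using h𝔞
  have hext : ∀ i (x : ↥(G i) ⊕ ↥(A i)), ∃ (d : ℕ) (t : D.Sec d),
      t.val i = Sum.elim (fun g => g.1) (fun a => a.1) x ∧
      ((∃ a, x = Sum.inr a) → ∀ j, t.val j ∈ 𝔞.ideal ⟨D.U j, hU j⟩) := by
    intro i x
    rcases x with ⟨g, hg⟩ | ⟨a, ha⟩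
    · obtain ⟨d, t, ht⟩ := D.exists_sec_val_eq hU i g
      exact ⟨d, t, ht, fun ⟨a, h⟩ => absurd h (by simp)⟩
    · have ha' : a ∈ 𝔞.ideal ⟨D.U i, hU i⟩ := by
        rw [← hA i]
        exact Ideal.subset_span ha
      obtain ⟨d, t, ht, hmem⟩ := exists_sec_val_eq_mem_ideal D hU 𝔞 i a ha'
      exact ⟨d, t, ht, fun _ => hmem⟩
  choose d t ht hmem using hext
  let N : ℕ := (Finset.univ : Finset (Σ i, ↥(G i) ⊕ ↥(A i))).sup (fun p => d p.1 p.2) + 1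
  have hdN : ∀ i x, d i x ≤ N := fun i x =>
    Nat.le_succ_of_le (Finset.le_sup (f := fun p : Σ i, ↥(G i) ⊕ ↥(A i) => d p.1 p.2) (Finset.mem_univ ⟨i, x⟩))
  let τ : ∀ i, ↥(G i) ⊕ ↥(A i) → D.Sec N := fun i x =>
    ((t i x).mul (GeneratingSections.Sec.pow D i (N - d i x))).cast (Nat.add_sub_cancel' (hdN i x))
  have hτ : ∀ i x j, (τ i x).val j = (t i x).val j * D.ratio j i ^ (N - d i x) := fun i x j => by
    simp only [τ, GeneratingSections.Sec.cast_val, GeneratingSections.Sec.mul_val, GeneratingSections.Sec.pow_val]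
  have hτhome : ∀ i x, (τ i x).val i = Sum.elim (fun g => g.1) (fun a => a.1) x := fun i x => by
    rw [hτ, D.ratio_self, one_pow, mul_one, ht]
  refine ⟨N, Nat.succ_pos _, fun i => ↥(G i) ⊕ ↥(A i), fun i => inferInstance, τ, fun i x => ∃ a, x = Sum.inr a,
    fun i => ?_, fun i x hx j => ?_, fun i => ?_⟩
  · -- (1) generation: the home values contain the chosen algebra generators
    rw [← top_le_iff, ← hG i]
    refine Subring.closure_mono (Set.union_subset_union_right _ ?_)
    intro g hg
    refine ⟨Sum.inl ⟨g, hg⟩, ?_⟩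
    change (τ i (Sum.inl ⟨g, hg⟩)).val i = g
    rw [hτhome]
    rfl
  · -- (2) flagged sections have all chart values in `𝔞`
    rw [hτ]
    exact Ideal.mul_mem_right _ _ (hmem i x hx j)
  · -- (3) the flagged home values generate `𝔞(U i)`
    rw [← hA i, Ideal.span_le]
    intro a ha
    refine Ideal.subset_span ⟨⟨Sum.inr ⟨a, ha⟩, ⟨a, ha⟩, rfl⟩, ?_⟩
    change (τ i (Sum.inr ⟨a, ha⟩)).val i = a
    rw [hτhome]
    rfl

/-! ## Step G: reindexing by `Fin (r + m + 1)` with the flagged indices last -/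

/-- **Reindexing with a decidable predicate last.** A finite type with at least one element outside `P` is in bijection with
`Fin (r + s + 1)` so that `P` corresponds to the indices `≥ r + 1`. [folklore] -/
theorem exists_equiv_fin_isA {M : Type} [Fintype M] (P : M → Prop) [DecidablePred P] (h0 : ∃ m, ¬ P m) :
    ∃ (r s : ℕ) (e : Fin (r + s + 1) ≃ M), ∀ c : Fin (r + s + 1), P (e c) ↔ r + 1 ≤ (c : ℕ) := by
  classical
  have hA : 0 < Fintype.card {m // ¬ P m} := Fintype.card_pos_iff.mpr ⟨⟨h0.choose, h0.choose_spec⟩⟩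
  obtain ⟨r, hr⟩ : ∃ r, Fintype.card {m // ¬ P m} = r + 1 := ⟨_, (Nat.sub_add_cancel hA).symm⟩
  set s := Fintype.card {m // P m} with hs
  let eA : Fin (r + 1) ≃ {m // ¬ P m} := (Fintype.equivFinOfCardEq hr).symm
  let eB : Fin s ≃ {m // P m} := (Fintype.equivFinOfCardEq rfl).symm
  let e : Fin (r + s + 1) ≃ M :=
    (finCongr (by omega : r + s + 1 = (r + 1) + s)).trans
      (finSumFinEquiv.symm.trans (((eA.sumCongr eB).trans (Equiv.sumComm _ _)).trans (Equiv.sumCompl P)))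
  refine ⟨r, s, e, fun c => ?_⟩
  -- split `c` according to `c < r + 1`
  by_cases hc : (c : ℕ) < r + 1
  · have hcast : finCongr (by omega : r + s + 1 = (r + 1) + s) c = Fin.castAdd s ⟨c, hc⟩ := Fin.ext rfl
    have he : e c = (eA ⟨c, hc⟩).1 := by
      simp only [e, Equiv.trans_apply, hcast, finSumFinEquiv_symm_apply_castAdd, Equiv.sumCongr_apply, Sum.map_inl,
        Equiv.sumComm_apply, Sum.swap_inl, Equiv.sumCompl_apply_inr]
    rw [he]
    exact ⟨fun h => absurd h (eA ⟨c, hc⟩).2, fun h => absurd h (by omega)⟩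
  · have hc' : r + 1 ≤ (c : ℕ) := by omega
    have hlt : (c : ℕ) - (r + 1) < s := by omega
    have hcast : finCongr (by omega : r + s + 1 = (r + 1) + s) c = Fin.natAdd (r + 1) ⟨(c : ℕ) - (r + 1), hlt⟩ :=
      Fin.ext (by simp; omega)
    have he : e c = (eB ⟨(c : ℕ) - (r + 1), hlt⟩).1 := by
      simp only [e, Equiv.trans_apply, hcast, finSumFinEquiv_symm_apply_natAdd, Equiv.sumCongr_apply, Sum.map_inr,
        Equiv.sumComm_apply, Sum.swap_inr, Equiv.sumCompl_apply_inl]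
    rw [he]
    exact ⟨fun _ => hc', fun _ => (eB ⟨(c : ℕ) - (r + 1), hlt⟩).2⟩

/-! ## Step J (chart identity): `toProj^*(x_{c'}/x_c) = s_{c'}/s_c` -/

/-- **The pull-back of the coordinate fraction `x_{c'}/x_c` along the morphism to `ℙ^d` defined by generating sections is the
ratio `s_{c'}/s_c`** (Hartshorne II Thm. 7.1, `GeneratingSections.app_sec` + `chartRingHom_frac`), read in `Γ(Y, ψ⁻¹ D₊(x_c))`.
[cite: Hartshorne1977, II Thm. 7.1] -/
theorem app_toProj_sec_frac {d : ℕ} {K : Type u} [Field K] {Y : Scheme.{u}} (G : GeneratingSections (Fin (d + 1)) Y)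
    (f₀ : Y ⟶ Spec (.of K)) (c c' : Fin (d + 1)) :
    (G.toProj f₀).app (ProjSpace.U c) (ProjSpace.sec c (frac K c c')) =
      rs (le_of_eq (G.toProj_preimage_basicOpen f₀ c)) (G.ratio c c') := by
  rw [GeneratingSections.app_sec, GeneratingSections.chartRingHom_frac]
  simp only [GeneratingSections.res, Scheme.Opens.topIso_hom, Scheme.Opens.ι_appLE]
  change ((Y.presheaf.map _ ≫ Y.presheaf.map _)).hom (G.ratio c c') = (Y.presheaf.map _).hom (G.ratio c c')
  rw [← Functor.map_comp]
  congr 3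

/-! ## The registered stub -/

/-- `x_{c'}/x_c` in the two presentations of the tree (`mk₁` of `ProjHomogeneousIdealSheaf` and `Segre.frac`). [folklore] -/
theorem mk₁_X_eq_frac_fin {N : ℕ} (k : Type) [Field k] (c c' : Fin (N + 1)) :
    mk₁ (grading (Fin (N + 1)) k) (X_mem_one (R := k) (r := N) (m := 0) c) 1 (X c') (X_mem_one (R := k) (r := N) (m := 0) c') =
      frac k c c' := by
  apply val_injective
  rw [val_mk₁]
  change _ = (Away.mk _ (X_mem k c) 1 (X c' ^ 1) (by simpa using X_mem k c')).val
  rw [Away.val_mk]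
  simp only [pow_one]

end LinearCentre

open LinearCentre in
/-- **STUB `stub_linearCentre_of_blowupModel`** (registered stub of skeleton v10b). If the integral hypersurface `H ⊆ ℙⁿ_k`
has a non-zero ideal sheaf `𝔞` all of whose blow-ups are regular, then `H` re-embeds as a closed subscheme `j : H → ℙ^{r+m}_k`
such that the coordinate linear subspace `Λ` killing the last `m` coordinates satisfies `Λ · 𝒪_H = 𝔞`; hence `j(H) ⊄ V(Λ)` and
the reduced strict transform of `j(H)` under every blow-up along `Λ` is regular. [OURS · L1 W4.5b]
[cite: Hartshorne1977, II Lemma 5.14, Thm. 7.1, Prop. 7.2, Cor. 7.15] -/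
theorem stub_linearCentre_of_blowupModel : ∀ p : ℕ, p.Prime → ∀ (k : Type) [Field k] [CharP k p] [IsAlgClosed k] (n : ℕ) (H : AlgebraicGeometry.Scheme.{0}) (ι : H ⟶ (Literature.AlgebraicGeometry.Motives.projectiveSpace n k).left), AlgebraicGeometry.IsClosedImmersion ι → AlgebraicGeometry.IsIntegral H → (∀ y : (Literature.AlgebraicGeometry.Motives.projectiveSpace n k).left, ∃ U : (Literature.AlgebraicGeometry.Motives.projectiveSpace n k).left.affineOpens, y ∈ (U : (Literature.AlgebraicGeometry.Motives.projectiveSpace n k).left.Opens) ∧ (ι.ker.ideal U).IsPrincipal) → (∃ 𝔞 : H.IdealSheafData, 𝔞 ≠ ⊥ ∧ ∀ (Z : AlgebraicGeometry.Scheme.{0}) (π : Z ⟶ H), Literature.AlgebraicGeometry.Resolution.IsBlowup π 𝔞 → Literature.AlgebraicGeometry.Resolution.Scheme.IsRegular Z) → ∃ (r m : ℕ) (fk : MvPolynomial.homogeneousSubmodule (Fin (r + m + 1)) k →+*ᵍ MvPolynomial.homogeneousSubmodule (Fin (r + 1)) k) (hfk' : HomogeneousIdeal.irrelevant (MvPolynomial.homogeneousSubmodule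 (Fin (r + 1)) k) ≤ (HomogeneousIdeal.irrelevant (MvPolynomial.homogeneousSubmodule (Fin (r + m + 1)) k)).map fk) (j : H ⟶ AlgebraicGeometry.Proj (MvPolynomial.homogeneousSubmodule (Fin (r + m + 1)) k)), (∀ a : k, fk (MvPolynomial.C a) = MvPolynomial.C a) ∧ (∀ i : Fin (r + m + 1), fk (MvPolynomial.X i) = if h : (i : ℕ) < r + 1 then MvPolynomial.X ⟨i, h⟩ else 0) ∧ AlgebraicGeometry.IsClosedImmersion j ∧ ¬ (Set.range j ⊆ ((AlgebraicGeometry.Proj.map fk hfk').ker.support : Set (AlgebraicGeometry.Proj (MvPolynomial.homogeneousSubmodule (Fin (r + m + 1)) k)))) ∧ (∀ (W : AlgebraicGeometry.Scheme.{0}) (τ₀ : W ⟶ AlgebraicGeometry.Proj (MvPolynomial.homogeneousSubmodule (Fin (r + m + 1)) k)), Literature.AlgebraicGeometry.Resolution.IsBlowup τ₀ (AlgebraicGeometry.Proj.map fk hfk').ker → Literature.AlgebraicGeometry.Resolution.Scheme.IsRegular (AlgebraicGeometry.Scheme.IdealSheafData.vanishingIdeal (⟨closure (τ₀ ⁻¹'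 (Set.range j \ ((AlgebraicGeometry.Proj.map fk hfk').ker.support : Set (AlgebraicGeometry.Proj (MvPolynomial.homogeneousSubmodule (Fin (r + m + 1)) k))))), isClosed_closure⟩ : TopologicalSpace.Closeds W)).subscheme) := by
  intro p hp k _ _ _ n H ι hι hH hloc hBM
  classical
  obtain ⟨𝔞, h𝔞0, hreg⟩ := hBM
  haveI := hH
  -- the generating-sections datum of `ι` and the structure morphism
  let ι' : H ⟶ Proj (grading (Fin (n + 1)) k) := ι
  haveI : IsClosedImmersion ι' := hι
  let D₀ : GeneratingSections (Fin (n + 1)) H := GeneratingSections.ofHom ι'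
  have hU₀ : ∀ i, IsAffineOpen (D₀.U i) := GeneratingSections.isAffineOpen_ofHom_U ι'
  haveI : IsProper (toSpec (Fin (n + 1)) k) := isProper_projectiveSpace n k
  let f : H ⟶ Spec (.of k) := ι' ≫ toSpec (Fin (n + 1)) k
  haveI : IsProper f := inferInstance
  haveI : IsLocallyNoetherian H := LocallyOfFiniteType.isLocallyNoetherian f
  have h𝔞fg : ∀ i, (𝔞.ideal ⟨D₀.U i, hU₀ i⟩).FG := fun i => by
    haveI := IsLocallyNoetherian.component_noetherian (X := H) ⟨D₀.U i, hU₀ i⟩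
    exact IsNoetherian.noetherian _
  obtain ⟨N, hN, L, instL, τ, isA, hgen, hmemA, hspanA⟩ := exists_adaptedFamily D₀ f hU₀ 𝔞 h𝔞fg
  haveI := instL
  -- reindexing with the `𝔞`-indices last
  let P : GeneratingSections.FIndex L → Prop := fun a => ∃ i l, a = ⟨i, some l⟩ ∧ isA i l
  obtain ⟨r, m', e, he⟩ := exists_equiv_fin_isA P ⟨⟨0, none⟩, by rintro ⟨i, l, h, -⟩; cases h⟩
  let E := D₀.famData hN L τ
  let j : H ⟶ Proj (grading (Fin (r + m' + 1)) k) := (E.reindex e).toProj f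
  have hj : IsClosedImmersion j := GeneratingSections.isClosedImmersion_toProj_famData D₀ hN L τ f hU₀ hgen e
  obtain ⟨fk, hfk', hfkC, hfkX⟩ := exists_kill k r m'
  -- `ker (Proj fk) · 𝒪_H = 𝔞`
  have hKEY : (Proj.map fk hfk').ker.comap j = 𝔞 := by
    refine Scheme.IdealSheafData.ext_of_iSup_eq_top (fun i => ⟨D₀.U i, hU₀ i⟩) D₀.iSup_U fun i => ?_
    obtain ⟨c, hec⟩ : ∃ c : Fin (r + m' + 1), e c = ⟨i, none⟩ := ⟨e.symm ⟨i, none⟩, e.apply_symm_apply _⟩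
    have hpre : j ⁻¹ᵁ Proj.basicOpen (grading (Fin (r + m' + 1)) k) (X c) = D₀.U i := by
      change (E.reindex e).toProj f ⁻¹ᵁ _ = _
      rw [GeneratingSections.toProj_preimage_basicOpen, GeneratingSections.reindex_U, hec]
      exact D₀.famData_U_none hN L τ i
    have hle : ((⟨D₀.U i, hU₀ i⟩ : H.affineOpens) : H.Opens) ≤ j ⁻¹ᵁ Proj.basicOpen (grading (Fin (r + m' + 1)) k) (X c) :=
      le_of_eq hpre.symm
    rw [ideal_comap_of_le j (Proj.map fk hfk').ker ⟨Proj.basicOpen _ (X c),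
        Proj.isAffineOpen_basicOpen _ (X c) (X_mem_one c) one_pos⟩ ⟨D₀.U i, hU₀ i⟩ hle,
      ker_projMap_kill_ideal_basicOpen fk hfk' hfkC hfkX c, Ideal.map_span, ← Set.range_comp]
    -- the value of the generator indexed by `c'` is the `i`-th chart value of the section `σ (e c')`
    have hratio : ∀ (a : GeneratingSections.FIndex L) (ha : a = ⟨i, none⟩) (b : GeneratingSections.FIndex L)
        (h : D₀.U i ≤ E.U a), rs h (E.ratio a b) = (D₀.famNewSec L τ b).val i := by
      intro a ha b h
      subst ha
      rw [GeneratingSections.famData_ratio_none, rs_rs]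
      exact rs_refl _
    have hval : ∀ c' : Fin (r + m' + 1),
        ((j.appLE (Proj.basicOpen (grading (Fin (r + m' + 1)) k) (X c)) (D₀.U i) hle).hom
          ((Proj.awayToSection (grading (Fin (r + m' + 1)) k) (X c)).hom
            (mk₁ (grading (Fin (r + m' + 1)) k) (X_mem_one c) 1 (X c') (X_mem_one c')))) =
          (D₀.famSec L τ (e c')).val i * D₀.ratio i (e c').1 ^ N := by
      intro c'
      rw [mk₁_X_eq_frac_fin, ← ProjSpace.sec_eq_awayToSection]
      change (H.presheaf.map (homOfLE hle).op).hom ((j.app (ProjSpace.U c)).hom (ProjSpace.sec c (frac k c c'))) = _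
      rw [app_toProj_sec_frac, ← D₀.famNewSec_val L τ (e c') i]
      change rs hle (rs _ (E.ratio (e c) (e c'))) = _
      rw [rs_rs]
      exact hratio (e c) hec (e c') _
    apply le_antisymm
    · -- generators indexed by killed `c'` are chart values of flagged sections, hence in `𝔞`
      refine Ideal.span_le.mpr ?_
      rintro _ ⟨c', rfl⟩
      rw [SetLike.mem_coe, Function.comp_apply, hval]
      obtain ⟨i', l, hm, hl⟩ := (he c'.1).mpr c'.2
      rw [hm]
      exact Ideal.mul_mem_right _ _ (hmemA i' l hl i)
    · -- the flagged home values of home `i` generate `𝔞(U i)` and are such generators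
      refine (hspanA i).trans (Ideal.span_mono ?_)
      rintro _ ⟨⟨l, hl⟩, rfl⟩
      have hP : P (e (e.symm ⟨i, some l⟩)) := ⟨i, l, e.apply_symm_apply _, hl⟩
      refine ⟨⟨e.symm ⟨i, some l⟩, (he _).mp hP⟩, ?_⟩
      rw [Function.comp_apply, hval]
      change (D₀.famSec L τ (e (e.symm ⟨i, some l⟩))).val i * D₀.ratio i (e (e.symm ⟨i, some l⟩)).1 ^ N = (τ i l).val i
      rw [e.apply_symm_apply, GeneratingSections.famSec_some, D₀.ratio_self, one_pow, mul_one]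
  -- `j(H) ⊄ V(Λ)` since `𝔞 ≠ 0`
  have hnot : ¬ (Set.range j ⊆ ((Proj.map fk hfk').ker.support : Set (Proj (grading (Fin (r + m' + 1)) k)))) := by
    intro hsub
    apply h𝔞0
    rw [← Scheme.IdealSheafData.support_eq_top_iff, ← hKEY, Scheme.IdealSheafData.support_comap]
    ext x
    simp only [Closeds.coe_preimage, Set.mem_preimage, Closeds.coe_top, Set.mem_univ, iff_true]
    exact hsub ⟨x, rfl⟩
  refine ⟨r, m', fk, hfk', j, hfkC, hfkX, hj, hnot, fun W τ₀ hτ₀ => ?_⟩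
  haveI : IsProper (toSpec (Fin (r + m' + 1)) k) := isProper_projectiveSpace (r + m') k
  haveI : IsLocallyNoetherian (Proj (grading (Fin (r + m' + 1)) k)) :=
    LocallyOfFiniteType.isLocallyNoetherian (toSpec (Fin (r + m' + 1)) k)
  exact isRegular_reducedStrictTransform_of_blowupModel j _ hnot (by rw [hKEY]; exact hreg) τ₀ hτ₀

end Summit.ResolutionOfSingularities.ResolutionOfSingularities.Cruxes.EquisingularLift.StrataSplit

end
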